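import Mathlib
import HarnessLib
import Summits.HubbardSuperconductivity.HubbardSuperconductivity.Theorems.KLProgrammeKLRegimeEngineE4ScaleDoorPkg
import Summits.HubbardSuperconductivity.HubbardSuperconductivity.Theorems.KLProgrammeKLRegimeEngineE4ScaleDoorFixed

/-!
# (E4)ₙ door — the FIXED-LABEL producer form at an arbitrary engine package `(G, Qf)`

Cell gate-hubbard-kl, seat hubbard-kl-k3c3-p2 (g6); joins `…E4ScaleDoorPkg` (p521159: `E4ScaleAtPkg G Qf E`) and `…E4ScaleDoorFixed` (p521997: the
satisfiable, fixed-label residual).  **`e4ScaleAtPkg_of_wtSum_fixed`**: a scale-uniform bound of the FIXED-LABEL weighted position sums under the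
stub-(c) binders at `(G, Qf P R)` — `ε_x³·Σ_x klScaleWt_n(positions of (0,x))·‖W̄_Ω(0,x)‖ ≤ klE0·(E·P.Klam·|U|)` for every label 4-tuple `Ω` — makes `E`
an admissible (E4)ₙ constant at `(G, Qf)` (then `engineFirstMoments_of_e4ScaleAtPkg` gives the clause at any `G'` with `E ≤ G'.cE4`).
Pure bookkeeping; nothing about the model is asserted.
-/

noncomputable section

namespace Summit.HubbardSuperconductivity.HubbardSuperconductivity.Theorems.EngineV8

set_option linter.dupNamespace false -- summit = problem name (single-conjunct summit), D-0017

open Real Finset Literature.MathematicalPhysics.QuantumLattice Literature.Probability.LatticeModels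
open Summit.HubbardSuperconductivity.HubbardSuperconductivity.Theorems.KLRegimeSplit
open Summit.HubbardSuperconductivity.HubbardSuperconductivity.Theorems.KLProgrammeLegKernels
open Summit.HubbardSuperconductivity.HubbardSuperconductivity.Theorems.DispersionFlow

/-- **Producer form, fixed labels, any package**: under the binders of stub (c) at `(G, Qf P R)`, a per-label-tuple bound of the fixed-label weighted
position sums `≤ klE0·(E·P.Klam·|U|)` gives `E4ScaleAtPkg G Qf E`. -/
theorem e4ScaleAtPkg_of_wtSum_fixed {G : GeoConsts} {Qf : SplitConsts → RenConsts → EngConsts} {E : ℝ}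
    (h : ∀ (P : SplitConsts) (R : RenConsts) (c : ℝ), P.WF → R.WF2 → 0 < c → c ≤ klEngC₃3 P R → ∀ μ ∈ klWindowC, ∀ U : ℝ, 0 < U →
      U ≤ klEngU₀4 P R c → ∀ β : ℝ, klBetaMin ≤ β → β ≤ Real.exp (c / U ^ 2) → ∀ K : TrigPolyC4v, FrameOK R U (nScales β) μ K →
      ∀ (L M : ℕ) [NeZero L] [NeZero M], klEngL₃ β U ≤ L → klEngM₃ β U L ≤ M → ∀ n : ℕ, 1 ≤ n → n ≤ nScales β + 1 →
      IsKLRegime U c (-(n : ℤ)) → HistP klPredsV16 L M G P (Qf P R) R β U μ K n →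
      KernelNormsV4 L M P (Qf P R) β U μ K n → (∀ j ≤ n, KernelNormsLevels L M P (Qf P R) β U μ K j) →
      ∀ Ω : Fin 4 → SectorLeg (sectorCount n),
        imagTimeWeight β M ^ 3 *
            ∑ x : Fin 3 → SpaceTimeIdx L M,
              klScaleWt L M β n ((univ.image (fun j : Fin 4 => (Matrix.vecCons (0 : SpaceTimeIdx L M) x j, Ω j))).image
                  (latticeLegPos (2 * (2 * M)))) *
                ‖klAnisoLegKernel L M β U μ K klE0 n 4 Ω (Matrix.vecCons (0 : SpaceTimeIdx L M) x)‖ ≤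
          klE0 * (E * P.Klam * |U|)) :
    E4ScaleAtPkg G Qf E := by
  intro P R c hP hR hc hc₃ μ hμ U hU hU₀ β hβ hβc K hK L M _ _ hL hM n hn hnle hreg hhist hE1 hlev Ω i k
  have hβ0 : 0 < β := lt_of_lt_of_le (by norm_num [klBetaMin]) hβ
  have hΛ := klth_klScale_pos n
  have hmain := (klScale_mul_firstMoment_le_wtSum_fixed (L := L) (M := M) hβ0.le U μ K n Ω i k).trans
    (h P R c hP hR hc hc₃ μ hμ U hU hU₀ β hβ hβc K hK L M hL hM n hn hnle hreg hhist hE1 hlev Ω)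
  have e := klScale_klE0_mul_four_pow n
  set B : ℝ := E * P.Klam * |U| with hB
  have h2 : klE0 * B / klScale klE0 n = B * (4 : ℝ) ^ n := by
    rw [show klE0 * B / klScale klE0 n = klScale klE0 n * (4 : ℝ) ^ n * B / klScale klE0 n by rw [e]]
    field_simp
  calc _ = klScale klE0 n * (imagTimeWeight β M ^ 3 *
          ∑ x : Fin 3 → SpaceTimeIdx L M,
            KLRegimeSplit.spaceTimeDist L M β (Matrix.vecCons (0 : SpaceTimeIdx L M) x i) (Matrix.vecCons (0 : SpaceTimeIdx L M) x k) *
              ‖klAnisoLegKernel L M β U μ K klE0 n 4 Ω (Matrix.vecCons (0 : SpaceTimeIdx L M) x)‖) / klScale klE0 n :=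
        (mul_div_cancel_left₀ _ hΛ.ne').symm
    _ ≤ klE0 * B / klScale klE0 n := div_le_div_of_nonneg_right hmain hΛ.le
    _ = B * (4 : ℝ) ^ n := h2

end Summit.HubbardSuperconductivity.HubbardSuperconductivity.Theorems.EngineV8

end
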